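import Mathlib

/-!
# StrengthenLineCone — MEMO-05 LEMMA 1 numerics in the kernel (plan-lens-HodgeAV-strengthen g6, MEMO-09 v1.4 (θ), ledger #71)

Token: line stmt-HodgeConjecture-18881 Cruxes/BlochSeedDiscOne/Lines/birth.lean 814a6a70c14e831a stub_rung_pad4_seedAt.

For LINE_h letters `ℓ = (h − c, c ζ)`, `ℓ' = (h − c', c' ζ')` (`c, c' ≥ 0`, `|ζ| = |ζ'| = 1`) the per-factor
class of `Hom(ℓ, ℓ')` (plain or twisted — twists are numerically trivial) is `(c − c', c' ζ' − c ζ)` in the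
causal-diamond coordinates of ledger #52, with self-intersection
`M_f² = 2((c − c')² − |c' ζ' − c ζ|²) = −4 c c' (1 − Re(ζ' ζ̄)) = −2 c c' |ζ − ζ'|² ≤ 0`.
Hence no incidence between LINE letters at levels `≤ h` is ample (timelike, `M_f² > 0`) on any factor, so the
(A3)/(A4) sub-families of c4-1's COROLLARY Σ-FLOOR are empty over the LINE_14 letter model (ledger #71).
This file proves exactly the displayed identity and inequality over `ℝ`/`ℂ` — elementary algebra, `import Mathlib`
only, no `sorry`/`axiom`. It says nothing about sheaves; nothing here is proved toward HC/HC_CM/HC_AV/№4/26512/18881/H2.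
-/

set_option linter.dupNamespace false
set_option autoImplicit false

namespace Summit.HodgeConjecture.HodgeConjecture.Cruxes.BlochSeedDiscOne.LineCone

open Complex

/-- `M_f²` of the per-factor difference class of two LINE letters `(h − c, c ζ)`, `(h − c', c' ζ')`. -/
noncomputable def lineDiffSq (c c' : ℝ) (ζ ζ' : ℂ) : ℝ :=
  2 * ((c - c') ^ 2 - normSq ((c' : ℂ) * ζ' - (c : ℂ) * ζ))

/-- The closed form: `M_f² = −4 c c' (1 − Re(ζ' ζ̄))` for unit phases. -/
theorem lineDiffSq_eq (c c' : ℝ) (ζ ζ' : ℂ) (hζ : normSq ζ = 1) (hζ' : normSq ζ' = 1) :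
    lineDiffSq c c' ζ ζ' = -4 * c * c' * (1 - (ζ' * (starRingEnd ℂ) ζ).re) := by
  unfold lineDiffSq
  rw [Complex.normSq_apply] at hζ hζ'
  simp only [Complex.normSq_apply, Complex.sub_re, Complex.sub_im, Complex.mul_re, Complex.mul_im,
    Complex.ofReal_re, Complex.ofReal_im, Complex.conj_re, Complex.conj_im]
  linear_combination (-2 * c ^ 2) * hζ + (-2 * c' ^ 2) * hζ'

/-- The same closed form as `−2 c c' |ζ − ζ'|²`. -/
theorem lineDiffSq_eq' (c c' : ℝ) (ζ ζ' : ℂ) (hζ : normSq ζ = 1) (hζ' : normSq ζ' = 1) :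
    lineDiffSq c c' ζ ζ' = -2 * c * c' * normSq (ζ - ζ') := by
  unfold lineDiffSq
  rw [Complex.normSq_apply] at hζ hζ'
  simp only [Complex.normSq_apply, Complex.sub_re, Complex.sub_im, Complex.mul_re, Complex.mul_im,
    Complex.ofReal_re, Complex.ofReal_im]
  linear_combination (-2 * c ^ 2 + 2 * c * c') * hζ + (-2 * c' ^ 2 + 2 * c * c') * hζ'

/-- LEMMA 1 (MEMO-05): LINE differences are never timelike — `M_f² ≤ 0` for letters at levels `≤ h`
(`c, c' ≥ 0`). -/
theorem lineDiffSq_nonpos (c c' : ℝ) (hc : 0 ≤ c) (hc' : 0 ≤ c') (ζ ζ' : ℂ)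
    (hζ : normSq ζ = 1) (hζ' : normSq ζ' = 1) : lineDiffSq c c' ζ ζ' ≤ 0 := by
  rw [lineDiffSq_eq' c c' ζ ζ' hζ hζ']
  have h1 : 0 ≤ normSq (ζ - ζ') := Complex.normSq_nonneg _
  have h2 : 0 ≤ c * c' := mul_nonneg hc hc'
  nlinarith [mul_nonneg h2 h1]

/-- Equality case: `M_f² = 0` iff `c = 0 ∨ c' = 0 ∨ ζ = ζ'` (the light cone), for unit phases. -/
theorem lineDiffSq_eq_zero_iff (c c' : ℝ) (ζ ζ' : ℂ) (hζ : normSq ζ = 1) (hζ' : normSq ζ' = 1) :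
    lineDiffSq c c' ζ ζ' = 0 ↔ c = 0 ∨ c' = 0 ∨ ζ = ζ' := by
  rw [lineDiffSq_eq' c c' ζ ζ' hζ hζ']
  constructor
  · intro h
    have : (-2 * c * c') * normSq (ζ - ζ') = 0 := by linarith
    rcases mul_eq_zero.mp this with h' | h'
    · have : c * c' = 0 := by linarith
      rcases mul_eq_zero.mp this with h'' | h''
      · exact Or.inl h''
      · exact Or.inr (Or.inl h'')
    · exact Or.inr (Or.inr (sub_eq_zero.mp (Complex.normSq_eq_zero.mp h')))
  · rintro (h | h | h)
    · simp [h]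
    · simp [h]
    · simp [h]

/-- Above the apex the sign can flip (why LEMMA 1 carries `c, c' ≥ 0`; the RB16 ∕ TW18x120 supports with
letters above level `h` are covered by the machine scan of MEMO-09 (θ), not by LEMMA 1):
`c = −3, c' = 2, ζ = 1, ζ' = i` gives `M_f² = 2(25 − 13) = 24 > 0`. -/
theorem lineDiffSq_above_apex_example : lineDiffSq (-3) 2 1 Complex.I = 24 := by
  unfold lineDiffSq
  simp [Complex.normSq_apply]
  norm_num

end Summit.HodgeConjecture.HodgeConjecture.Cruxes.BlochSeedDiscOne.LineCone
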